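import Summits.HodgeConjecture.HodgeConjecture.Theorems.MarkmanPartnerTransportHKSpreadDefs
import Summits.HodgeConjecture.HodgeConjecture.Theorems.MarkmanPartnerTransportK3Sq2TypeHodgeOfCycleInducedGenerator
import Summits.HodgeConjecture.HodgeConjecture.Theorems.MarkmanPartnerTransportPicardThreeK3SquaresAlgebraicLocusSpreadSection

/-!
# Route MarkmanPartnerTransport · crux `LowPicardRealMultiplication` (stmt-HodgeConjecture-19653) — an `X`-side
# spread family makes the real-multiplication generator cycle-induced, hence HC⁴(X) (closed form of the `X`-side
# spread line, partner-free, every Picard rank)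

Consumer of `HKSpreadFamily X hX t` (`Theorems/MarkmanPartnerTransportHKSpreadDefs`), the `X`-side twin of the
K3-square line «maximal-family spread»: the flat section is algebraic on the fibres over a dominant family, so
everywhere (`AlgebraicLocusSpread.forall_cls_mem_algebraicClasses_of_denseRange_of_section'`, UNCONDITIONAL in the
tree — Charles–Schnell's structure theorem + Baire + Voisin II Thm. 4.18), in particular at the fibre `X ⊗ X`;
transported along `fibreIso` it is an algebraic class `Z ∈ A⁴(X × X)` with `t = [Z]_*`; then the `X`-side rung F4
`hodgeConjectureFor_of_cycleInducedGenerator{,_of_charlesMarkman}` (gen 7) gives HC⁴(X) when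
`End_Hdg T(X)_ℚ = ℚ[t|_T]`.

* `HKSpreadFamily.exists_algebraicClass` — `t` is induced by an algebraic class on `X × X` (unconditional);
* `HKSpreadFamily.hodgeConjectureFor` — marked smooth projective `K3^{[2]}`-type `X`, `t` rational,
  type-preserving, generating (`f = Σ aᵢ tⁱ` on `T(X)` for every rational Hodge `f` killing `N¹` with
  transcendental image), `F : HKSpreadFamily X hX t` ⇒ `HodgeConjectureFor 4 X` modulo {Verbitsky–Guan, O'Grady,
  `QInvAlgebraic`}; `HKSpreadFamily.hodgeConjectureFor_of_charlesMarkman` — modulo {Verbitsky–Guan, O'Grady,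
  Charles–Markman 2013}. This is the INDEX-row shape of crux #5 after gen 7: KERNEL ∕ {(I1′-X) universal RM
  family of `K3^{[2]}`-type fourfolds with flat generator, (I2-X) a dominating cycle-carrying family, and the three
  printed facts}.

No definition, no sorry; prover seat hodge-nonav-19652-p1 (gen 7), `--supports stmt-HodgeConjecture-19653`.
Nothing here proves the crux, the target, or HC; `HKSpreadFamily` is not claimed inhabited.

References: van Geemen–Schütt, Forum Math. Sigma 13 (2025) e2, §3.4 and §4.8; E. Markman, Compos. Math. 160
(2024) Thm. 1.1; F. Charles–E. Markman, Compos. Math. 149 (2013) Thm. 1.1; C. Voisin, *Hodge Theory II*,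
Thm. 4.18, §7.3.2; M. Varesco, Math. Z. 305 (2023) §2.
-/

noncomputable section

set_option linter.dupNamespace false

open Module CategoryTheory MonoidalCategory CartesianMonoidalCategory
open Literature.AlgebraicTopology.SingularHomology Literature.Geometry.Kaehler
open Literature.AlgebraicGeometry Literature.AlgebraicGeometry.Motives Literature.AlgebraicGeometry.HodgeTheory
open Literature.AlgebraicGeometry.Hyperkaehler Literature.AlgebraicGeometry.Surfaces
open Summit.HodgeConjecture.HodgeConjecture.Theorems.NikulinTwinTransport
open Summit.HodgeConjecture.HodgeConjecture.Theorems.MarkmanPartnerTransport.BBFPositivity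

namespace Summit.HodgeConjecture.HodgeConjecture.Theorems.MarkmanPartnerTransport

/-- `MarkedK3Sq[X, φ, P, z]`: VERBATIM the `let MarkedK3Sq := …` binder of the route declarations of
MarkmanPartnerTransport (clauses (m1)–(m6)). Local notation only. -/
local notation3 (prettyPrint := false) "MarkedK3Sq[" X ", " φ ", " P ", " z "]" =>
  (((IsIntegralClass P ∧ ∀ Q : complexBetti X (2 * 4), IsIntegralClass Q → ∃ n : ℤ, Q = n • P) ∧
    (∀ c : complexBetti X 2, IsIntegralClass c ↔ ∃ v : K3HilbertIndex → ℤ, φ c = fun i => (v i : ℂ)) ∧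
    (∀ a : complexBetti X 2, cupPowTwo a 4 = ((3 : ℂ) * (k3HilbertForm 2 (φ a) (φ a)) ^ 2) • P) ∧
    (IsOfHodgeType 4 X 2 2 0 (LinearEquiv.symm φ z) ∧
      ∀ τ : complexBetti X 2, IsOfHodgeType 4 X 2 2 0 τ → ∃ t : ℂ, τ = t • LinearEquiv.symm φ z) ∧
    (∀ c : complexBetti X 2, IsOfHodgeType 4 X 2 1 1 c ↔
      (k3HilbertForm 2 (φ c) z = 0 ∧ k3HilbertForm 2 (φ c) (star z) = 0)) ∧
    (k3HilbertForm 2 z z = 0 ∧ 0 < (k3HilbertForm 2 (star z) z).re)))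

variable {X : SchemeOver ℂ} {hX : IsSmoothProjective 4 X} {φ : complexBetti X 2 ≃ₗ[ℂ] (K3HilbertIndex → ℂ)}
  {P : complexBetti X (2 * 4)} {z : K3HilbertIndex → ℂ} {t : complexBetti X 2 →ₗ[ℂ] complexBetti X 2}

namespace HKSpreadFamily

/-- **A spread family makes `t` cycle-induced — UNCONDITIONAL**: the flat section of an `HKSpreadFamily X hX t`
is algebraic over the image of the dominant `classify`, hence on every fibre
(`AlgebraicLocusSpread.forall_cls_mem_algebraicClasses_of_denseRange_of_section'`), in particular at `pt₁`;
pulled back along `fibreIso` (`map_mem_algebraicClasses_of_isIso`) it is an algebraic `Z ∈ A⁴(X × X)` with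
`t = [Z]_*`. [cite: VoisinHodgeII2003, Thm. 4.18 and §7.3.2] [cite: GeemenSchutt2023, §4.8] -/
theorem exists_algebraicClass (F : HKSpreadFamily X hX t) :
    ∃ Z ∈ algebraicClasses (X ⊗ X) 4, ∀ y : complexBetti X 2,
      t y = corrAction complexOrientationFamily hX hX (rfl : 2 + 2 * 4 = 2 + 2 * 4) Z y := by
  haveI := F.base_irreducible
  haveI := F.param_irreducible
  haveI := F.param_isSeparated
  haveI := F.param_locallyOfFiniteType
  haveI := F.param_nonempty
  refine ⟨complexBetti.map F.fibreIso.hom (2 * 4) ((F.flatSection F.pt₁).clsAt (F.flatSection_pt F.pt₁)),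
    map_mem_algebraicClasses_of_isIso F.fibreIso.hom ?_, F.induces⟩
  exact AlgebraicLocusSpread.forall_cls_mem_algebraicClasses_of_denseRange_of_section' F.family
    F.isSmoothProjectiveFamily F.total_quasiProjective F.base_quasiProjective F.base_smooth
    F.flatSection F.flatSection_continuous F.flatSection_pt F.classify F.classify_denseRange
    F.algebraic_over_param F.pt₁

/-- **The `X`-side spread line, closed form**: for a marked smooth projective `K3^{[2]}`-type fourfold `X`, `t`
rational and type-preserving with `End_Hdg T(X)_ℚ = ℚ[t|_T]` (every rational Hodge endomorphism of `H²(X)`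
killing `N¹(X)` with transcendental image is a rational polynomial in `t` on `T(X)`), an `HKSpreadFamily X hX t`
gives `HodgeConjectureFor 4 X` — `t` is cycle-induced (`exists_algebraicClass`) and the `X`-side F4
`hodgeConjectureFor_of_cycleInducedGenerator` concludes. Modulo {Verbitsky–Guan, O'Grady, `QInvAlgebraic`}.
[cite: Varesco2023, §2 (p. 8)] [cite: Markman2024, §1.1 Thm. 1.1] [cite: VoisinHodgeII2003, Thm. 4.18 and §7.3.2] -/
theorem hodgeConjectureFor (F : HKSpreadFamily X hX t)
    (hV : VerbitskyGuan_cohomology_K3HilbertSquareType) (hO : OGrady2008_dualBBFClass_algebraic)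
    (hQ : PartnerLattice.QInvAlgebraic) (hK : IsOfK3HilbertSquareType X) (hM : MarkedK3Sq[X, φ, P, z])
    (ht_rat : ∀ y, IsRationalClass y → IsRationalClass (t y))
    (ht_typ : ∀ (a b : ℕ) y, IsOfHodgeType 4 X 2 a b y → IsOfHodgeType 4 X 2 a b (t y))
    (hgen : ∀ f : complexBetti X 2 →ₗ[ℂ] complexBetti X 2, (∀ y, IsRationalClass y → IsRationalClass (f y)) →
      (∀ (i j : ℕ) y, IsOfHodgeType 4 X 2 i j y → IsOfHodgeType 4 X 2 i j (f y)) →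
      (∀ d : complexBetti X 2, d ∈ algebraicClasses X 1 → f d = 0) →
      (∀ y : complexBetti X 2, ∀ d : complexBetti X 2, d ∈ algebraicClasses X 1 →
        k3HilbertForm 2 (φ (f y)) (φ d) = 0) →
      ∃ (n : ℕ) (a : Fin n → ℚ), ∀ y : complexBetti X 2,
        (∀ d : complexBetti X 2, d ∈ algebraicClasses X 1 → k3HilbertForm 2 (φ y) (φ d) = 0) →
        f y = ∑ i : Fin n, ((a i : ℂ) • (t ^ (i : ℕ)) y)) :
    HodgeConjectureFor 4 X :=
  PartnerLattice.hodgeConjectureFor_of_cycleInducedGenerator hV hO hQ hX hK hM t ht_rat ht_typ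
    F.exists_algebraicClass hgen

/-- **The `X`-side spread line from the route's published facts** (Verbitsky–Guan, O'Grady, Charles–Markman 2013):
an `HKSpreadFamily X hX t` for a generator `t` of `End_Hdg T(X)_ℚ` of a marked smooth projective `K3^{[2]}`-type
`X` gives `HodgeConjectureFor 4 X`. The INDEX-row shape of crux #5 after gen 7: KERNEL ∕ {(I1′-X), (I2-X), three
printed facts}. CONDITIONAL; credits nothing; the structure is not claimed inhabited.
[cite: CharlesMarkman2013, Thm. 1.1 (§1)] [cite: Markman2024, §1.1 Thm. 1.1] [cite: Varesco2023, §2 (p. 8)] -/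
theorem hodgeConjectureFor_of_charlesMarkman (F : HKSpreadFamily X hX t)
    (hV : VerbitskyGuan_cohomology_K3HilbertSquareType) (hO : OGrady2008_dualBBFClass_algebraic)
    (hB : CharlesMarkman2013_lefschetzStandard_K3HilbertType) (hK : IsOfK3HilbertSquareType X)
    (hM : MarkedK3Sq[X, φ, P, z])
    (ht_rat : ∀ y, IsRationalClass y → IsRationalClass (t y))
    (ht_typ : ∀ (a b : ℕ) y, IsOfHodgeType 4 X 2 a b y → IsOfHodgeType 4 X 2 a b (t y))
    (hgen : ∀ f : complexBetti X 2 →ₗ[ℂ] complexBetti X 2, (∀ y, IsRationalClass y → IsRationalClass (f y)) →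
      (∀ (i j : ℕ) y, IsOfHodgeType 4 X 2 i j y → IsOfHodgeType 4 X 2 i j (f y)) →
      (∀ d : complexBetti X 2, d ∈ algebraicClasses X 1 → f d = 0) →
      (∀ y : complexBetti X 2, ∀ d : complexBetti X 2, d ∈ algebraicClasses X 1 →
        k3HilbertForm 2 (φ (f y)) (φ d) = 0) →
      ∃ (n : ℕ) (a : Fin n → ℚ), ∀ y : complexBetti X 2,
        (∀ d : complexBetti X 2, d ∈ algebraicClasses X 1 → k3HilbertForm 2 (φ y) (φ d) = 0) →
        f y = ∑ i : Fin n, ((a i : ℂ) • (t ^ (i : ℕ)) y)) :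
    HodgeConjectureFor 4 X :=
  PartnerLattice.hodgeConjectureFor_of_cycleInducedGenerator_of_charlesMarkman hV hO hB hX hK hM t ht_rat
    ht_typ F.exists_algebraicClass hgen

end HKSpreadFamily

end Summit.HodgeConjecture.HodgeConjecture.Theorems.MarkmanPartnerTransport
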